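import Literature.Claims.NS.Faliush2026
import Literature.Analysis.FluidPDE.TorusNSSobolevControlLifespan
import Literature.Analysis.FluidPDE.TorusNSVectorFieldGevrey
import HarnessLib

/-!
# C141 `Faliush2026` — refutation of Step L1a (Lemma 1, first display, p. 2 l. 37–40) by the
# single-mode shear heat flow

D-0090 NS-CLAIMS SWEEP, row C141 (`Literature.Claims.NS.Faliush2026`, D. Faliush, «Global Regularity for 3D
Navier–Stokes via Critical Gaussian-Weighted Energy Estimates», Zenodo 10.5281/zenodo.18406805, 4 pp.).

**Printed statement (Lemma 1, p. 2 l. 37–40).** «For smooth solutions,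
`d/dt G_σ(u) = −2ν D̃_σ(u) + 2⟨e^{σΔ}(u·∇u), e^{σΔ}u⟩`», with `G_σ(u) = ‖e^{σΔ}u‖²_{L²}` (§2.3) and the
«modified dissipation» `D̃_σ(u) := ‖Δ e^{σΔ/2} u‖²_{L²}` of (2); typed (spectrally, on `𝕋³`) as
`Literature.Claims.NS.Faliush2026.Step_L1a`.

**Countermodel.** Pizzocchero's transversal single mode `P = Re(e_{k₀} z)`, `k₀ = (1,0,0)`, `z = (0,1,0)`,
generates the exact classical solution `U(t) = e^{−4π²νt} P` of the unforced system on `[0, ∞) × 𝕋³` (zero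
pressure, `(P·∇)P = 0`; tree `Torus.isClassicalNSSolutionOn_expDecay_realTrigPoly_singleton`). Its Fourier
support is `{±k₀}` (`|k₀|² = 1`), so with `x := e^{−4π²σ}`:
`G_σ(U(s)) = e^{−8π²νs}·x²/2`, `D̃_σ(U(0)) = (4π²)²·x/2`, and the transfer pairing vanishes. The true
derivative of `s ↦ G_σ(U(s))` at `s = 0` (within `[0,1]`) is `−4π²ν·x²`, the printed one is `−16π⁴ν·x`;
uniqueness of one-sided derivatives on `[0,1]` forces `x = 4π² > 1`, contradicting `x = e^{−4π²σ} < 1`.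
(The printed dissipation symbol `(4π²|k|²)² e^{−4π²σ|k|²}` is not the derivative's `4π²|k|² e^{−8π²σ|k|²}`:
the identity fails for EVERY `ν, σ > 0` already on one Fourier mode.)

* `not_Step_L1a : ¬ Literature.Claims.NS.Faliush2026.Step_L1a` (class FL, breaks at Lemma 1 first display).

WHAT THIS IS NOT: not a claim about NS regularity or blow-up; not a claim about any author beyond the
typed locator.
-/

set_option linter.dupNamespace false

noncomputable section

open Set UnitAddTorus
open Literature.Analysis.FunctionSpaces Literature.Analysis.FunctionSpaces.Torus
open Literature.Analysis.FluidPDE Literature.Analysis.FluidPDE.Torus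
open Literature.Claims.NS.Faliush2026

namespace Summit.NavierStokesRegularity.NavierStokesRegularity.Theorems.Faliush2026

/-- The mode `k₀ = (1, 0, 0) ∈ ℤ³`. -/
def k0 : Z3 := fun i => if i = 0 then 1 else 0

/-- The (constant) coefficient family `z = (0, 1, 0) ∈ ℂ³`, transversal to `k₀`. -/
def cz : Z3 → EuclideanSpace ℂ (Fin 3) := fun _ => EuclideanSpace.single 1 1

/-- The shear profile `P = Re(e_{k₀} z)`. -/
def P : T3 → E3 := realTrigPoly {k0} cz

/-- The exact solution `U(t) = e^{−4π²|k₀|²νt} P`. -/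
def U (ν : ℝ) : ℝ → T3 → E3 :=
  fun t x => Real.exp (-(ν * (4 * Real.pi ^ 2 * freqNormSq k0)) * t) • P x

/-- kit lemma (plumbing) [folklore] -/ theorem k0_apply (i : Fin 3) : k0 i = if i = 0 then 1 else 0 := rfl

/-- kit lemma (plumbing) [folklore] -/ theorem freqNormSq_k0 : freqNormSq k0 = 1 := by
  simp [freqNormSq, k0_apply]

/-- kit lemma (plumbing) [folklore] -/ theorem neg_k0_ne : -k0 ≠ k0 := by
  intro h
  have h0 := congrFun h 0
  simp [k0_apply] at h0

/-- kit lemma (plumbing) [folklore] -/ theorem transversal : ∑ j, (k0 j : ℂ) * cz k0 j = 0 := by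
  simp [k0_apply, cz]

/-- kit lemma (plumbing) [folklore] -/ theorem norm_cz : ‖cz k0‖ = 1 := by
  simp [cz]

/-- `U` solves the unforced Navier–Stokes system classically on `[0, 1]` with zero pressure. -/
theorem isClassicalNSSolutionOn_U (ν : ℝ) :
    Torus.IsClassicalNSSolutionOn (Icc 0 1) ν 0 (U ν) (fun _ _ => 0) :=
  (Torus.isClassicalNSSolutionOn_expDecay_realTrigPoly_singleton ν transversal).mono
    Icc_subset_Ici_self (uniqueDiffOn_Icc one_pos)

/-- kit lemma (plumbing) [folklore] -/ theorem U_zero (ν : ℝ) : U ν 0 = P := by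
  funext x
  simp [U]

/-- Fourier support of the profile: `‖P̂(m)‖ = 1/2` on `{±k₀}`, `0` elsewhere. -/
theorem norm_coeff_P (m : Z3) : ‖coeff P m‖ = if m = k0 ∨ m = -k0 then 1 / 2 else 0 := by
  have hne := neg_k0_ne
  show ‖mFourierCoeff (EuclideanSpace.complexify ∘ realTrigPoly {k0} cz) m‖ = _
  rw [mFourierCoeff_realTrigPoly_singleton]
  by_cases h1 : m = k0
  · have h2 : m ≠ -k0 := fun h => hne (h.symm.trans h1)
    rw [if_pos h1, if_neg h2, if_pos (Or.inl h1), EuclideanSpace.conjVec_zero, add_zero, norm_smul,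
      norm_inv, Complex.norm_ofNat, norm_cz]
    norm_num
  · by_cases h2 : m = -k0
    · rw [if_neg h1, if_pos h2, if_pos (Or.inr h2), zero_add, norm_smul, norm_inv, Complex.norm_ofNat,
        EuclideanSpace.norm_conjVec, norm_cz]
      norm_num
    · rw [if_neg h1, if_neg h2, if_neg (not_or.2 ⟨h1, h2⟩), EuclideanSpace.conjVec_zero, add_zero,
        smul_zero, norm_zero]

/-- Weighted Plancherel sums of the profile: `Σ_m φ(m)‖P̂(m)‖² = φ(k₀)/2` for even-at-`k₀` weights. -/
theorem tsum_weight (φ : Z3 → ℝ) (hφ : φ (-k0) = φ k0) :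
    ∑' m : Z3, φ m * ‖coeff P m‖ ^ 2 = φ k0 / 2 := by
  have hne := neg_k0_ne
  simp_rw [norm_coeff_P]
  rw [tsum_eq_sum (s := ({k0, -k0} : Finset Z3)) fun m hm => by
    rw [Finset.mem_insert, Finset.mem_singleton, not_or] at hm
    rw [if_neg (not_or.2 ⟨hm.1, hm.2⟩)]; ring]
  rw [Finset.sum_pair hne.symm, if_pos (Or.inl rfl), if_pos (Or.inr rfl), hφ]
  ring

/-- `G_σ(U(s)) = e^{2as}·e^{−8π²σ}/2`, `a = −4π²ν|k₀|²`. -/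
theorem Gw_U (ν σ s : ℝ) :
    Gw σ (U ν s) = Real.exp (-(ν * (4 * Real.pi ^ 2 * freqNormSq k0)) * s) ^ 2 *
      (Torus.heatCoeff (2 * σ) k0 / 2) := by
  have hc : ∀ m : Z3, ‖coeff (U ν s) m‖ =
      |Real.exp (-(ν * (4 * Real.pi ^ 2 * freqNormSq k0)) * s)| * ‖coeff P m‖ :=
    fun m => norm_mFourierCoeff_complexify_const_smul _ _ _
  unfold Gw
  simp_rw [hc, mul_pow, sq_abs, mul_left_comm (Torus.heatCoeff _ _)]
  rw [tsum_mul_left, tsum_weight (fun m => Torus.heatCoeff (2 * σ) m) (by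
    simp only [Torus.heatCoeff_apply, freqNormSq_neg])]

/-- `D̃_σ(P) = (4π²|k₀|²)²·e^{−4π²σ|k₀|²}/2`. -/
theorem Dw_P (σ : ℝ) : Dw σ P = lapSymb k0 ^ 2 * Torus.heatCoeff σ k0 / 2 := by
  unfold Dw
  exact tsum_weight (fun m => lapSymb m ^ 2 * Torus.heatCoeff σ m) (by
    simp only [lapSymb, Torus.heatCoeff_apply, freqNormSq_neg])

/-- The transfer pairing vanishes on the shear profile: `(P·∇)P = 0`. -/
theorem pairW_convect_P (σ : ℝ) : pairW σ (Torus.convect P P) P = 0 := by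
  have hconv : Torus.convect P P = fun x => (0 : ℝ) • P x := by
    funext x
    rw [zero_smul]
    exact Torus.convect_realTrigPoly_singleton_self_eq_zero transversal x
  have h0 : ∀ m : Z3, coeff (Torus.convect P P) m = 0 := by
    intro m
    rw [← norm_eq_zero, hconv]
    rw [show ‖coeff (fun x => (0 : ℝ) • P x) m‖ = |(0 : ℝ)| * ‖coeff P m‖ from
      norm_mFourierCoeff_complexify_const_smul _ _ _, abs_zero, zero_mul]
  unfold pairW
  simp_rw [h0, inner_zero_left, map_zero, mul_zero, tsum_zero]

/-- **Refutation of Step L1a** (`Literature.Claims.NS.Faliush2026.Step_L1a`, Lemma 1 first display,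
p. 2 l. 37–40, «d/dt G_σ(u) = −2ν D̃_σ(u) + 2⟨e^{σΔ}(u·∇u), e^{σΔ}u⟩ for smooth solutions»): false as typed —
class FL (breaks at Lemma 1). Witness: `ν = σ = T = 1`, `t = 0`, the shear heat flow `U`. -/
theorem not_Step_L1a : ¬ Step_L1a := by
  intro h
  set a : ℝ := -((1 : ℝ) * (4 * Real.pi ^ 2 * freqNormSq k0)) with ha
  set g : ℝ := Torus.heatCoeff (2 * 1) k0 / 2 with hg
  have hclaim := h 1 one_pos 1 one_pos (U 1) (fun _ _ => 0) (isClassicalNSSolutionOn_U 1) 1 one_pos 0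
    ⟨le_rfl, zero_le_one⟩
  have hfun : (fun s => Gw 1 (U 1 s)) = fun s => Real.exp (a * s) ^ 2 * g := by
    funext s
    rw [Gw_U]
  rw [hfun, U_zero, Dw_P, pairW_convect_P] at hclaim
  -- the true derivative at `s = 0`
  have h1 : HasDerivAt (fun s : ℝ => a * s) a 0 := by
    simpa using (hasDerivAt_id (0 : ℝ)).const_mul a
  have h4 : HasDerivAt (fun s : ℝ => Real.exp (a * s) ^ 2 * g) (2 * a * g) 0 := by
    have h3 := ((h1.exp).pow 2).mul_const g
    refine h3.congr_deriv ?_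
    simp [Real.exp_zero]
  have huniq : UniqueDiffWithinAt ℝ (Icc (0 : ℝ) 1) 0 :=
    uniqueDiffOn_Icc one_pos 0 (left_mem_Icc.2 zero_le_one)
  have heq := huniq.eq_deriv _ h4.hasDerivWithinAt hclaim
  -- evaluate the symbols at `|k₀|² = 1`
  rw [hg, ha, Torus.heatCoeff_apply, Torus.heatCoeff_apply, lapSymb, freqNormSq_k0] at heq
  set x : ℝ := Real.exp (-(4 * Real.pi ^ 2 * 1 * 1)) with hx
  have hx2 : Real.exp (-(4 * Real.pi ^ 2 * 1 * (2 * 1))) = x ^ 2 := by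
    rw [hx, ← Real.exp_nat_mul]
    congr 1
    push_cast
    ring
  rw [hx2] at heq
  have hxpos : 0 < x := Real.exp_pos _
  have hx1 : x < 1 := Real.exp_lt_one_iff.2 (by nlinarith [Real.pi_gt_three])
  have hpi := Real.pi_gt_three
  have key : (4 * Real.pi ^ 2) * x * (x - 4 * Real.pi ^ 2) = 0 := by
    linear_combination (-1 : ℝ) * heq
  rcases mul_eq_zero.1 key with h' | h'
  · have : (0 : ℝ) < 4 * Real.pi ^ 2 * x := by positivity
    exact this.ne' h'
  · nlinarith


end Summit.NavierStokesRegularity.NavierStokesRegularity.Theorems.Faliush2026
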